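import Summits.CriticalPhenomena.PercolationContinuityZ3.Theorems.FK.InfiniteVolumeDLRWiringKernel
import Summits.CriticalPhenomena.PercolationContinuityZ3.Theorems.FK.InfiniteVolumeDLRInvariantLimit
import HarnessLib

/-!
# FK-continuity transplant, FO-10 (infinite-volume structure): Grimmett 2006, Theorem (4.31), for the limit points of
# box measures with ARBITRARY ONE-CLASS BOUNDARY WIRINGS `B_k ⊆ ∂Λ_{N_k}` — they are limit points of `W_{p,q}` proper,
# hence DLR random-cluster measures under the 0/1-infinite-cluster property (every `q > 0`, `d ≥ 2`)

Registered R108 (cell INBOX l.7499, 2026-08-25); registry row FO-10b-g420; label DLW-B (coordinator fk-4 g227).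
Cell `fk-continuity` (bschramm), FO-10b lineage; support file for the FK-continuity transplant
(`--supports stmt-CriticalPhenomena-4575`); builds on p205010 (kernel theorem, internal audit signed; external
expert review pending). CONDITIONAL cell (FH AND TP_FK open at the same `p` for `q > 1`; K1); the transplant is a
typed reduction, not a proof of FK continuity — this file is UNCONDITIONAL infinite-volume structure for `d ≥ 2`,
`0 ≤ p ≤ 1` and every `q > 0` (no FKG input); no defs, no named facts, no sorries, standard axioms; NOT a binder
discharge, NOT `_r4`; `_r3` « 2 / 0 ☑ » unchanged, n_open = 2.

## What this file proves

FO-10a's `BoundaryWiringLimitPoints.lean` studies the local limit points `P` of box measures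
`φ^{B_k}_{Λ_{N_k},p,q} = rcMeasure (finsetGraph (zdGraph d) (box d (N_k))) p q (B_k)` (read on `ℤ^d` through
`liftEdges`) with arbitrary wired classes `B_k ⊆ ∂Λ_{N_k}`, `N_k → ∞`: they exist along subsequences and, for `q ≥ 1`,
lie in the sandwich class `FKGibbs d p q`. Whether they are DLR random-cluster measures was left open there (fkp-10a
NEXT-STEPS (f)). By `InfiniteVolumeDLRWiringKernel.exists_lattice_wiring` each wiring `B_k` is realised by a lattice
configuration `ξ_k` off `E_{Λ_{N_k}}`, and `φ^{ξ_k}_{Λ_{N_k},p,q}` agrees with `φ^{B_k}_{Λ_{N_k},p,q}` on every event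
insensitive to `ξ_k` — eventually on every local event. Hence:

* `rcCondPartition_eq_rcPartitionFunction_of_wiring`, `rcCondLaw_real_preimage_inter_eq_of_wiring` — two more readings
  of the companion's kernel identity: `Z^ξ_Λ = Z^B_{(Λ,E_Λ),p,q}`, and the law of `ω ∩ E_Λ` under `φ^ξ_{Λ,p,q}` is `φ^B_{Λ,p,q}`;
* `eventually_mem_edgesIn_box` — bookkeeping: every lattice edge is eventually inside `E_{Λ_{N_k}}`;
* **`exists_tendsto_rcCondLaw_of_tendsto_wiring`** — every local limit `P` of one-class-wired box measures is a local
  limit of finite-volume measures `φ^{ξ_k}_{Λ_{N_k},p,q}` with LATTICE boundary conditions `ξ_k ⊆ E_{Λ_{N_k+1}} ∖ E_{Λ_{N_k}}`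
  (a limit point of Grimmett's `W_{p,q}`, Def. (4.26), in the vocabulary of `InfiniteVolumeDLRLocalLimit.lean`);
* **`isDLRRandomCluster_of_tendsto_wiring`** — THEOREM (4.31) for these limit points: if `P`-a.s. there is at most
  one infinite cluster, `P ∈ R_{p,q}` (DLL-C `isDLRRandomCluster_of_tendsto_rcCondLaw`);
  `isDLRRandomCluster_of_tendsto_wiring_of_forall_percolatesAt_eq_zero` — non-percolating limit points are DLR;
  `isDLRRandomCluster_of_tendsto_wiring_of_shift_invariant` — translation-invariant limit points are DLR
  (`0 < p ≤ 1`; uniqueness from Burton–Keane without ergodicity, DRE-B′ `InfiniteVolumeDLRInvariantLimit.lean`).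

Honest framing: for `q ≥ 1` and `φ⁰_{p,q} = φ¹_{p,q}` every such limit point is `φ⁰_{p,q}` (BCW-C) and DLR by FO-06b;
the content here is the non-uniqueness regime and `q < 1`, where the 0/1-infinite-cluster property (or translation
invariance, or non-percolation) is the only input. No statement about `p_c(q)`.

## References

* G. Grimmett, *The Random-Cluster Model*, Springer 2006 (`book:grimmett2006-random-cluster-model`): §4.2
  (4.11)–(4.12) [PDF pp. 71–72]; Def. (4.26)–(4.30), Thm. (4.31), Thm. (4.33)(b),(c) [PDF pp. 79–86]. [Grimmett2006]
-/

noncomputable section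

open MeasureTheory Set Filter
open scoped Topology ENNReal

namespace Summit.CriticalPhenomena.PercolationContinuityZ3.Theorems.FK

open Literature.Probability.Percolation Literature.Probability.LatticeModels

variable {d : ℕ}

/-! ### §2′ Two more readings of the kernel identity of `InfiniteVolumeDLRWiringKernel.lean` -/

section Kernel

variable {p q : ℝ} {Λ : Finset (Site d)} {B : Set ↥Λ} {ξ : BondConfig (Site d)}

/-- The normalisation under a boundary condition realising the wiring `B` is the partition function
`Z^B_{(Λ,E_Λ),p,q}` of the Literature's finite-volume measure. [cite: Grimmett2006, §1.2 eq. (1.3), §4.2 (4.12)] -/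
theorem rcCondPartition_eq_rcPartitionFunction_of_wiring (p q : ℝ) (hξ : Disjoint ξ ↑(edgesIn (zdGraph d) Λ))
    (hR : ∀ u v : ↥Λ, (openGraph ξ).Reachable (u : Site d) v ↔ u = v ∨ (u ∈ B ∧ v ∈ B)) :
    rcCondPartition p q Λ ξ = rcPartitionFunction (finsetGraph (zdGraph d) Λ) p q B := by
  rw [rcCondPartition_eq_of_wiring p q hξ hR, rcPartitionFunction_finsetGraph_eq_sum]

/-- **The law of the configuration INSIDE `Λ` under `φ^ξ_{Λ,p,q}` is `φ^B_{Λ,p,q}`** (`ξ` realising the one-class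
wiring `B`; `0 ≤ p ≤ 1`, `q > 0`): for every measurable `A`, `φ^ξ_{Λ,p,q}{ω : ω ∩ E_Λ ∈ A} = φ^B_{Λ,p,q}(liftEdges Λ ⁻¹' A)`.
[cite: Grimmett2006, §4.2 (4.11)–(4.12), Lemma (4.13)] -/
theorem rcCondLaw_real_preimage_inter_eq_of_wiring (hp : p ∈ Set.Icc (0 : ℝ) 1) (hq : 0 < q)
    (hξ : Disjoint ξ ↑(edgesIn (zdGraph d) Λ))
    (hR : ∀ u v : ↥Λ, (openGraph ξ).Reachable (u : Site d) v ↔ u = v ∨ (u ∈ B ∧ v ∈ B))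
    {A : Set (BondConfig (Site d))} (hAm : MeasurableSet A) :
    (rcCondLaw p q Λ ξ).real ((fun ω => ω ∩ ↑(edgesIn (zdGraph d) Λ)) ⁻¹' A) =
      (rcMeasure (finsetGraph (zdGraph d) Λ) p q B).real (liftEdges Λ ⁻¹' A) := by
  refine rcCondLaw_real_eq_of_wiring_of_forall hp hq hξ hR ((measurable_inter_const _) hAm) fun η hη => ?_
  rw [Set.mem_preimage, Set.union_inter_distrib_right, Disjoint.inter_eq hξ, Set.union_empty,
    Set.inter_eq_left.2 (Finset.coe_subset.2 hη)]

end Kernel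

/-! ### §3 Local limits of one-class-wired box measures are local limits of `φ^{ξ_k}_{Λ_{N_k},p,q}` with lattice `ξ_k` -/

section LimitPoints

variable {p q : ℝ} {P : Measure (BondConfig (Site d))} {Ns : ℕ → ℕ} {B : ∀ k : ℕ, Set ↥(box d (Ns k))}

/-- Along boxes `Λ_{N_k}` with `N_k → ∞`, every lattice edge eventually lies in `E_{Λ_{N_k}}`. [folklore] -/
theorem eventually_mem_edgesIn_box (hNs : Tendsto Ns atTop atTop) {x y : Site d} (hxy : (zdGraph d).Adj x y) :
    ∀ᶠ k in atTop, s(x, y) ∈ edgesIn (zdGraph d) (box d (Ns k)) := by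
  have hx : x ∈ ⋃ L : ℕ, ((box d L : Finset (Site d)) : Set (Site d)) := by rw [iUnion_coe_box]; trivial
  have hy : y ∈ ⋃ L : ℕ, ((box d L : Finset (Site d)) : Set (Site d)) := by rw [iUnion_coe_box]; trivial
  obtain ⟨L₁, hL₁⟩ := Set.mem_iUnion.1 hx
  obtain ⟨L₂, hL₂⟩ := Set.mem_iUnion.1 hy
  filter_upwards [tendsto_atTop.1 hNs (max L₁ L₂)] with k hk
  rw [mem_edgesIn_iff]
  refine ⟨(zdGraph d).mem_edgeSet.2 hxy, fun v hv => ?_⟩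
  rcases Sym2.mem_iff.1 hv with rfl | rfl
  · exact box_mono d ((le_max_left _ _).trans hk) (Finset.mem_coe.1 hL₁)
  · exact box_mono d ((le_max_right _ _).trans hk) (Finset.mem_coe.1 hL₂)

/-- **Local limits of one-class-wired box measures are local limits of finite-volume random-cluster measures with
LATTICE boundary conditions** (`d ≥ 2`, `0 ≤ p ≤ 1`, `q > 0`): if `N_k → ∞`, `B_k ⊆ ∂Λ_{N_k}` and
`φ^{B_k}_{Λ_{N_k},p,q}(A) → P(A)` for every local event `A`, then for the lattice configurations `ξ_k` realising the
wirings (`exists_lattice_wiring`) also `φ^{ξ_k}_{Λ_{N_k},p,q}(A) → P(A)` for every local event `A` — so the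
one-class-wiring limit points of `BoundaryWiringLimitPoints.lean` are limit points of Grimmett's `W_{p,q}` proper, in
the vocabulary of `InfiniteVolumeDLRLocalLimit.lean`. [cite: Grimmett2006, Def. (4.26) (W_{p,q}), §4.2 (4.11)–(4.12)] -/
theorem exists_tendsto_rcCondLaw_of_tendsto_wiring [IsFiniteMeasure P] (hd : 2 ≤ d) (hp : p ∈ Set.Icc (0 : ℝ) 1)
    (hq : 0 < q) (hNs : Tendsto Ns atTop atTop) (hB : ∀ k, B k ⊆ boxBC d true (Ns k))
    (hP : ∀ A : Set (BondConfig (Site d)), IsLocalEvent A →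
      Tendsto (fun k => (rcMeasure (finsetGraph (zdGraph d) (box d (Ns k))) p q (B k)).real
        (liftEdges (box d (Ns k)) ⁻¹' A)) atTop (𝓝 (P.real A))) :
    ∃ ξ : ℕ → BondConfig (Site d), (∀ k, ξ k ⊆ (zdGraph d).edgeSet) ∧
      (∀ k, Disjoint (ξ k) ↑(edgesIn (zdGraph d) (box d (Ns k)))) ∧
      (∀ k, ξ k ⊆ ↑(edgesIn (zdGraph d) (box d (Ns k + 1)))) ∧
      (∀ k, ∀ u v : ↥(box d (Ns k)), (openGraph (ξ k)).Reachable (u : Site d) v ↔ u = v ∨ (u ∈ B k ∧ v ∈ B k)) ∧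
      ∀ A : Set (BondConfig (Site d)), IsLocalEvent A →
        Tendsto (fun k => rcCondLaw p q (box d (Ns k)) (ξ k) A) atTop (𝓝 (P A)) := by
  choose ξ hξE hξd hξl hξR using fun k => exists_lattice_wiring hd (Ns k) (hB k)
  refine ⟨ξ, hξE, hξd, hξl, hξR, fun A hA => ?_⟩
  have hAm : MeasurableSet A := measurableSet_of_isLocalEvent_holds hA
  obtain ⟨F, hF⟩ := hA
  -- eventually every lattice pair of `F` lies in `E_{Λ_{N_k}}`, hence off `ξ_k`
  have hev : ∀ᶠ k in atTop, ∀ e ∈ F.filter (· ∈ (zdGraph d).edgeSet), e ∈ edgesIn (zdGraph d) (box d (Ns k)) := by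
    refine (Filter.eventually_all_finset _).2 fun e he => ?_
    have heE := (Finset.mem_filter.1 he).2
    induction e using Sym2.ind with
    | h x y => exact eventually_mem_edgesIn_box hNs ((zdGraph d).mem_edgeSet.1 heE)
  rw [← ofReal_measureReal (μ := P) (s := A)]
  refine (ENNReal.tendsto_ofReal (hP A ⟨F, hF⟩)).congr' ?_
  filter_upwards [hev] with k hk
  refine (rcCondLaw_apply_eq_of_wiring hp hq (hξd k) (hξR k) hAm fun ω => ?_).symm
  refine (determinedBy_iff A ↑F).1 hF (ω ∪ ξ k) ω ?_
  have h0 : ξ k ∩ ↑F = ∅ := Set.eq_empty_of_forall_notMem fun e he =>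
    Set.disjoint_left.1 (hξd k) he.1
      (Finset.mem_coe.2 (hk e (Finset.mem_filter.2 ⟨Finset.mem_coe.1 he.2, hξE k he.1⟩)))
  rw [Set.union_inter_distrib_right, h0, Set.union_empty]

/-! ### §4 Grimmett's Theorem (4.31) for the limit points of one-class-wired box measures -/

variable (d) in
/-- **Grimmett 2006, Theorem (4.31), for limit points of box measures with arbitrary one-class boundary wirings**
(`d ≥ 2`, `0 ≤ p ≤ 1`, `q > 0`): if `N_k → ∞`, `B_k ⊆ ∂Λ_{N_k}`, `φ^{B_k}_{Λ_{N_k},p,q}(A) → P(A)` for every local event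
`A` (`P` a probability measure) and `P`-almost surely there is at most one infinite cluster, then `P ∈ R_{p,q}`
(`IsDLRRandomCluster d p q P`). The 0/1-infinite-cluster property is the ONLY input (no FKG, every `q > 0`).
[cite: Grimmett2006, Thm. (4.31) pp. 81–86, Def. (4.26)–(4.30)] -/
theorem isDLRRandomCluster_of_tendsto_wiring [IsProbabilityMeasure P] (hd : 2 ≤ d) (hp : p ∈ Set.Icc (0 : ℝ) 1)
    (hq : 0 < q) (hNs : Tendsto Ns atTop atTop) (hB : ∀ k, B k ⊆ boxBC d true (Ns k))
    (hP : ∀ A : Set (BondConfig (Site d)), IsLocalEvent A →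
      Tendsto (fun k => (rcMeasure (finsetGraph (zdGraph d) (box d (Ns k))) p q (B k)).real
        (liftEdges (box d (Ns k)) ⁻¹' A)) atTop (𝓝 (P.real A)))
    (huniq : ∀ᵐ ω ∂P, numInfiniteClusters ω ≤ 1) :
    IsDLRRandomCluster d p q P := by
  obtain ⟨ξ, hξE, -, -, -, hconv⟩ := exists_tendsto_rcCondLaw_of_tendsto_wiring hd hp hq hNs hB hP
  exact isDLRRandomCluster_of_tendsto_rcCondLaw d hp hq hξE (fun x y hxy => eventually_mem_edgesIn_box hNs hxy)
    hconv huniq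

variable (d) in
/-- **Non-percolating limit points of one-class-wired box measures are DLR random-cluster measures** (`d ≥ 2`,
`0 ≤ p ≤ 1`, every `q > 0`, no FKG input): with `N_k`, `B_k`, `P` as above, if `P(x ↔ ∞) = 0` for every site `x`,
then `P ∈ R_{p,q}`. [cite: Grimmett2006, Thm. (4.31) pp. 81–86] -/
theorem isDLRRandomCluster_of_tendsto_wiring_of_forall_percolatesAt_eq_zero [IsProbabilityMeasure P] (hd : 2 ≤ d)
    (hp : p ∈ Set.Icc (0 : ℝ) 1) (hq : 0 < q) (hNs : Tendsto Ns atTop atTop) (hB : ∀ k, B k ⊆ boxBC d true (Ns k))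
    (hP : ∀ A : Set (BondConfig (Site d)), IsLocalEvent A →
      Tendsto (fun k => (rcMeasure (finsetGraph (zdGraph d) (box d (Ns k))) p q (B k)).real
        (liftEdges (box d (Ns k)) ⁻¹' A)) atTop (𝓝 (P.real A)))
    (hperc : ∀ x : Site d, P (percolatesAt x) = 0) :
    IsDLRRandomCluster d p q P := by
  obtain ⟨ξ, hξE, -, -, -, hconv⟩ := exists_tendsto_rcCondLaw_of_tendsto_wiring hd hp hq hNs hB hP
  exact isDLRRandomCluster_of_tendsto_rcCondLaw_of_forall_percolatesAt_eq_zero d hp hq hξE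
    (fun x y hxy => eventually_mem_edgesIn_box hNs hxy) hconv hperc

variable (d) in
/-- **Translation-invariant limit points of one-class-wired box measures are DLR random-cluster measures** (`d ≥ 2`,
`0 < p ≤ 1`, every `q > 0`): with `N_k`, `B_k`, `P` as above, if `P` is invariant under the lattice translations, then
`P ∈ R_{p,q}` — the 0/1-infinite-cluster property being supplied by Burton–Keane for translation-invariant finite-energy
measures (`InfiniteVolumeDLRInvariantLimit.lean`, no ergodicity, no FKG). [cite: Grimmett2006, Thm. (4.31), Thm. (4.33)(b),(c) pp. 81–86] -/
theorem isDLRRandomCluster_of_tendsto_wiring_of_shift_invariant [IsProbabilityMeasure P] (hd : 2 ≤ d)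
    (hp : p ∈ Set.Ioc (0 : ℝ) 1) (hq : 0 < q) (hNs : Tendsto Ns atTop atTop) (hB : ∀ k, B k ⊆ boxBC d true (Ns k))
    (hP : ∀ A : Set (BondConfig (Site d)), IsLocalEvent A →
      Tendsto (fun k => (rcMeasure (finsetGraph (zdGraph d) (box d (Ns k))) p q (B k)).real
        (liftEdges (box d (Ns k)) ⁻¹' A)) atTop (𝓝 (P.real A)))
    (hshift : ∀ (v : Site d) {S : Set (BondConfig (Site d))}, MeasurableSet S →
      P (BondConfig.relabel (sym2Equiv (Site.shift v)) ⁻¹' S) = P S) :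
    IsDLRRandomCluster d p q P := by
  obtain ⟨ξ, hξE, -, -, -, hconv⟩ :=
    exists_tendsto_rcCondLaw_of_tendsto_wiring hd ⟨hp.1.le, hp.2⟩ hq hNs hB hP
  exact isDLRRandomCluster_of_tendsto_rcCondLaw_of_shift_invariant d hp hq hξE
    (fun x y hxy => eventually_mem_edgesIn_box hNs hxy) hconv hshift

end LimitPoints

end Summit.CriticalPhenomena.PercolationContinuityZ3.Theorems.FK

end
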